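import Literature.Analysis.OperatorTheory.Enflo2023.StepRealisationOrbit
import Literature.Analysis.OperatorTheory.Enflo2023.StepRealisationToy
import Literature.Analysis.OperatorTheory.Enflo2023.StepRealisationDiag
import HarnessLib

/-!
# Enflo (2023), v2 pp.16–20: the finite-dimensional calibrations refute the ORBIT form `IndepRunD` too

P. H. Enflo, *On the invariant subspace problem in Hilbert spaces*, arXiv:2305.15442v2 (2023) — a CLAIMED result
under adjudication; nothing in this file asserts the manuscript's theorem.

`StepRealisationOrbit` weakens the located Part-B gap `IndepRunκ` (first-order independence (34), two-fold, each
functional at its own scale, ONE modulus `σ`, asked on the reachability class `ReachN`, which is a union of level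
sets of `(ε, εθ)`) to its orbit form `IndepRunD` (asked only at the states the realised construction visits:
commutant steps `W(1 + ι p)`, `‖p‖ ≤ 2β/σ`, exact ratio `1 − β`), still sufficient for a non-trivial closed
invariant subspace (`nis_of_indepRunD`, `isp_of_partBResidualIndepD`).

This file records that the two model refutations of `IndepRunκ` in the tree are ORBIT refutations: their proofs
query the hypothesis only at self-pivots `(s, s)` along the run that `exists_state_stepκ` itself builds, so they go
through VERBATIM for `IndepRunD`.
* `Toy.indepRunD_etheta_eq_zero`, `Toy.not_indepRunD` — the type-2 model `T = τJ` on `ℂ²` (`0 < τ ≤ σ/250`):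
  direction freezing of `y_n` (`Toy.step_eta`, `Toy.bracket_bound`).
* `Diag.indepRunD_etheta_eq_zero`, `Diag.not_indepRunD` — the type-1 model `T = τ·diag(1, ½)` with a genuine `V_y`
  over the shift on `ℓ²` (`0 < τ ≤ σ/100`): the two-component potential `cyc` cannot be killed at the rate the
  contraction `(1 − β)` demands (`Diag.cyc_step`, `Diag.cyc_le`).
The tree's `Toy.indepRunκ_etheta_eq_zero` / `Diag.indepRunκ_etheta_eq_zero` are these composed with
`indepRunD_of_indepRunκ`.  So the orbit re-typing does not rescue the residual in finite dimension: what the text's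
passage L655–L677 needs beyond (34)-at-one-state is a DYNAMICAL input (infinite dimension / no invariant subspaces /
non-closed range entering the δ₂-independence "for a sequence of n's"), unstated in v2.

Both model operators have invariant subspaces (finite dimension), so nothing here contradicts an assertion of the
text about operators without them; see `pub-enflo/GAP.md` §"Formaliser 2, generation 15".
-/

noncomputable section

open scoped InnerProductSpace ComplexConjugate
open ContinuousLinearMap Filter Topology

namespace Literature.Analysis.OperatorTheory.Enflo2023

namespace StepRealisation

open MCStep

/-! ### A. The type-2 toy model `T = τJ` on `ℂ²` -/

namespace Toy

variable {τ : ℝ} {x₀ : C2}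

/-- **The orbit-form hypothesis fails in the toy model (quantitative form): `IndepRunD T_τ x₀ J (ιS J) σ β s₀`
forces `(εθ)₀ = 0`** (`0 < τ`, `2β/σ ≤ 1/2`-regime via `β ≤ σ²/1000`).  Same proof as `indepRunκ_etheta_eq_zero`:
every visited state is its own pivot, the visited states are exactly the run `exists_state_stepκ` builds, along it
`(εθ)_n = (1−β)ⁿ(εθ)₀` while the tilt `η_n = (y_n)₁/(y_n)₀` moves by at most `4βτ/σ` per step (`step_eta`), and
the state bound `0.09τ ≤ (εθ)(1 + (τ + |η|)²)` (`bracket_bound`) is eventually violated. [cite: Enflo2023, v2 (34)–(35) p.16; (45)–(46) p.19; p.19–20] -/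
theorem indepRunD_etheta_eq_zero (hτ : 0 < τ) (hx₀ : ‖x₀‖ = 1) {σ β : ℝ} (hσ : 0 < σ) (hσ1 : σ ≤ 1)
    (hβ0 : 0 < β) (hβ : β ≤ σ ^ 2 / 1000) (s₀ : State (Tτ τ) x₀ J)
    (hstart : (0.09 : ℝ) + (22 / σ + 1) * s₀.etheta ≤ s₀.ε ^ 2 ∧
      s₀.ε ^ 2 + (22 / σ + 1) * s₀.etheta ≤ 0.49)
    (h : IndepRunD (Tτ τ) x₀ J (ιS J) σ β s₀) : s₀.etheta = 0 := by
  obtain ⟨hιs, hι1, hιS⟩ := ιS_props J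
  have hS : ‖J‖ ≤ 1 := norm_J_le
  have hσ2 : σ ^ 2 ≤ σ := by nlinarith
  have hβ1 : β < 1 := by linarith
  have hν : 2 * β / σ ≤ 1 / 2 := by
    rw [div_le_iff₀ hσ]; linarith
  by_contra hne
  have he0 : 0 < s₀.etheta := lt_of_le_of_ne (s₀.etheta_nonneg hx₀ hS) (Ne.symm hne)
  by_cases hdeg : (s₀.V e0) 0 = 0
  · -- degenerate start: `W e₁ = 0`, independence fails at the first pivot
    have hV1 : s₀.V e1 = 0 := by
      rw [← J_e0, state_intertwine, J_apply, hdeg, zero_smul, smul_zero]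
    have hW1 : Wn s₀ e1 = 0 := by rw [Wn, smul_apply, hV1, smul_zero]
    have hind : IndepAtκ (ιS J) σ s₀ (x₀ - s₀.v) :=
      h s₀ s₀ ReachD.start ReachD.start (invP_self' _ s₀ _) he0
    have hbr : IsBracket (Wn s₀) x₀ s₀.v := isBracket_Wn hx₀ s₀ he0
    have hvz : s₀.v = bz (Wn s₀) x₀ := hbr.unique (isBracket_bz (Wn s₀) x₀)
    have hind' : IndepBrκ (Wn s₀) x₀ (x₀ - bz (Wn s₀) x₀) (ιS J) σ := by
      have h' : IndepBrκ (Wn s₀) x₀ (x₀ - s₀.v) (ιS J) σ := hind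
      rw [hvz] at h'
      exact h'
    exact not_indepBrκ_of_degenerate hW1 x₀ hσ hind'
  · -- non-degenerate start: the tilt recursion along the orbit
    set η₀ : ℂ := (s₀.V e0) 1 / (s₀.V e0) 0 with hη₀d
    have hη₀ : (s₀.V e0) 1 = η₀ * (s₀.V e0) 0 := by rw [hη₀d, div_mul_cancel₀ _ hdeg]
    set δ : ℝ := 2 * τ * (2 * β / σ) with hδ
    have hδ0 : 0 ≤ δ := by positivity
    set K : ℝ := 22 / σ + 1 with hK
    have hK0 : 0 ≤ K := by positivity
    have iter : ∀ n : ℕ, ∃ s : State (Tτ τ) x₀ J, ReachD (ιS J) σ β s₀ s ∧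
        s.etheta = (1 - β) ^ n * s₀.etheta ∧
        ∃ η : ℂ, (s.V e0) 1 = η * (s.V e0) 0 ∧ ‖η‖ ≤ ‖η₀‖ + n * δ := by
      intro n
      induction n with
      | zero => exact ⟨s₀, ReachD.start, by rw [pow_zero, one_mul], η₀, hη₀, by simp⟩
      | succ n ih =>
        obtain ⟨s, hs, hes, η, hη, hηn⟩ := ih
        have he : 0 < s.etheta := by rw [hes]; exact mul_pos (pow_pos (by linarith) _) he0
        have hRs : |s.ε ^ 2 - s₀.ε ^ 2| ≤ K * (s₀.etheta - s.etheta) := hs.radInv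
        have hβe : K * β * s.etheta ≤ K * s.etheta := by
          have h1 : β * s.etheta ≤ s.etheta := mul_le_of_le_one_left he.le hβ1.le
          have h2 := mul_le_mul_of_nonneg_left h1 hK0
          linarith [h2]
        have hab := abs_le.1 hRs
        have hlo : (0.09 : ℝ) + (22 / σ + 1) * β * s.etheta ≤ s.ε ^ 2 := by
          rw [← hK]; linarith [hab.1, hstart.1]
        have hhi : s.ε ^ 2 + (22 / σ + 1) * β * s.etheta ≤ 0.49 := by
          rw [← hK]; linarith [hab.2, hstart.2]
        obtain ⟨s', h1, -, h3, h4, p, hp, hV'⟩ := exists_state_stepκ hιs hι1 hιS hx₀ s he hσ hσ1 hβ0.le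
          hβ (x₀ - s.v) (h s s hs hs (invP_self' _ s _) he) hlo hhi
        have hN : ‖ιS J p‖ ≤ 2 * β / σ := (hι1 p).trans hp
        obtain ⟨η', hη', hη'n⟩ := step_eta hτ.le (Wn_intertwine s) (Wn_tilt s hη) (ιS J p) hN hν
        refine ⟨s', hs.step he ⟨p, hp, hV'⟩ h1 h3 h4, by rw [h1, hes, pow_succ]; ring, η',
          by rw [hV']; exact hη', ?_⟩
        push_cast
        linarith [hη'n, hηn]
    -- the state bound along the orbit
    have hbound : ∀ n : ℕ, 0.09 * τ ≤ (1 - β) ^ n * s₀.etheta * (1 + (τ + ‖η₀‖ + n * δ) ^ 2) := by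
      intro n
      obtain ⟨s, hs, hes, η, hη, hηn⟩ := iter n
      have he : 0 < s.etheta := by rw [hes]; exact mul_pos (pow_pos (by linarith) _) he0
      have hbr : IsBracket (Wn s) x₀ s.v := isBracket_Wn hx₀ s he
      have hes' : ‖adjoint (Wn s) s.v‖ ^ 2 = s.etheta := by rw [etheta_eq_eth, eth_eq_of_isBracket hbr]
      have hb := bracket_bound hτ (Wn_intertwine s) (Wn_tilt s hη) hbr (s.window hx₀).1
        (norm_x₀_sub_v_ge hx₀ s)
      rw [hes', hes] at hb
      have hmono : 1 + (τ + ‖η‖) ^ 2 ≤ 1 + (τ + ‖η₀‖ + n * δ) ^ 2 := by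
        have h1 : τ + ‖η‖ ≤ τ + ‖η₀‖ + n * δ := by linarith
        have h2 := pow_le_pow_left₀ (by positivity) h1 2
        linarith
      exact hb.trans (mul_le_mul_of_nonneg_left hmono (mul_nonneg (pow_nonneg (by linarith) _) he0.le))
    obtain ⟨n, hn⟩ := exists_geometric_lt (r := 1 - β) (E := s₀.etheta) (D := τ + ‖η₀‖) (δ := δ)
      (c := 0.09 * τ) (by linarith) (by linarith) he0.le (by positivity) hδ0 (by positivity)
    have hb := hbound n
    have : (1 - β) ^ n * s₀.etheta * (1 + (τ + ‖η₀‖ + n * δ) ^ 2) < 0.09 * τ := by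
      have e : τ + ‖η₀‖ + n * δ = (τ + ‖η₀‖) + n * δ := by ring
      rw [e]; exact hn
    linarith

/-- **`IndepRunD` IS FALSE IN THE TOY MODEL**: for `0 < τ ≤ σ/250`, `0 < σ ≤ 1`, `0 < β ≤ σ²/1000` there is an
admissible start (unit `x₀`, true MC state `s₀` over `J` with the start margin and `(εθ)₀ > 0`) at which the
orbit-form hypothesis fails. [cite: Enflo2023, v2 (34) p.16; p.19–20] -/
theorem not_indepRunD {τ σ β : ℝ} (hτ : 0 < τ) (hσ : 0 < σ) (hσ1 : σ ≤ 1) (hτσ : τ ≤ σ / 250)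
    (hβ0 : 0 < β) (hβ : β ≤ σ ^ 2 / 1000) :
    ∃ (x₀ : C2) (s₀ : State (Tτ τ) x₀ J), ‖x₀‖ = 1 ∧ 0 < s₀.etheta ∧
      ((0.09 : ℝ) + (22 / σ + 1) * s₀.etheta ≤ s₀.ε ^ 2 ∧ s₀.ε ^ 2 + (22 / σ + 1) * s₀.etheta ≤ 0.49) ∧
      ¬ IndepRunD (Tτ τ) x₀ J (ιS J) σ β s₀ := by
  obtain ⟨x₀, s₀, hx₀, he, -, hstart⟩ := exists_start hτ hσ hσ1 hτσ
  exact ⟨x₀, s₀, hx₀, he, hstart, fun h => he.ne' (indepRunD_etheta_eq_zero hτ hx₀ hσ hσ1 hβ0 hβ s₀ hstart h)⟩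

end Toy

/-! ### B. The type-1 model `T = τ·diag(1, ½)` with `V_y` over the shift on `ℓ²` -/

namespace Diag

open Vy

variable {τ : ℝ} {x₀ : C2}

/-- **The orbit-form hypothesis fails in the type-1 model (quantitative form): `IndepRunD T_τ x₀ S (ιS S) σ β s₀`
forces `(εθ)₀ = 0`** (`0 < τ ≤ σ/100`).  Same proof as `indepRunκ_etheta_eq_zero`: every visited state is its
own pivot, the visited states are exactly the run `exists_state_stepκ` builds; along it `(εθ)_n = (1−β)ⁿ(εθ)₀`
while each commutant step multiplies the two eigen-coefficients by `1 + n_i` with `|n₀ − n₁| ≤ 4βτ/σ`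
(`cyc_step`), and `cyc_le` (`0.0081·Δ·cyc ≤ (εθ)²`) is eventually violated since `(1−β)(1 + 8βτ/σ) < 1`.
[cite: Enflo2023, v2 (34)–(35) p.16; (45)–(46) p.19; p.19–20] -/
theorem indepRunD_etheta_eq_zero (hτ : 0 < τ) (hx₀ : ‖x₀‖ = 1) {σ β : ℝ} (hσ : 0 < σ) (hσ1 : σ ≤ 1)
    (hτσ : τ ≤ σ / 100) (hβ0 : 0 < β) (hβ : β ≤ σ ^ 2 / 1000) (s₀ : State (TD τ) x₀ S)
    (hstart : (0.09 : ℝ) + (22 / σ + 1) * s₀.etheta ≤ s₀.ε ^ 2 ∧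
      s₀.ε ^ 2 + (22 / σ + 1) * s₀.etheta ≤ 0.49)
    (h : IndepRunD (TD τ) x₀ S (ιS S) σ β s₀) : s₀.etheta = 0 := by
  obtain ⟨hιs, hι1, hιS⟩ := ιS_props (S : ℓ2 →L[ℂ] ℓ2)
  have hS : ‖(S : ℓ2 →L[ℂ] ℓ2)‖ ≤ 1 := norm_S_le
  have hτ2 : τ ≤ 1 / 2 := by linarith
  have hlt : τ < 1 := by linarith
  have hσ2 : σ ^ 2 ≤ σ := by nlinarith
  have hβ1 : β < 1 := by linarith
  have hν : 2 * β / σ ≤ 1 / 2 := by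
    rw [div_le_iff₀ hσ]; linarith
  have hν0 : 0 ≤ 2 * β / σ := by positivity
  by_contra hne
  have he0 : 0 < s₀.etheta := lt_of_le_of_ne (s₀.etheta_nonneg hx₀ hS) (Ne.symm hne)
  by_cases hdeg : cf s₀.V 0 = 0 ∨ cf s₀.V 1 = 0
  · -- degenerate start: independence fails at the first pivot
    obtain ⟨r, hr, hW⟩ := Wn_eq_smul hx₀ s₀ he0
    have hc : cf (Wn s₀) 0 = 0 ∨ cf (Wn s₀) 1 = 0 := by
      rw [hW, cf_smul, cf_smul]
      rcases hdeg with h0 | h1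
      · left; rw [h0, mul_zero]
      · right; rw [h1, mul_zero]
    have hind : IndepAtκ (ιS S) σ s₀ (x₀ - s₀.v) :=
      h s₀ s₀ ReachD.start ReachD.start (invP_self' _ s₀ _) he0
    have hbr : IsBracket (Wn s₀) x₀ s₀.v := isBracket_Wn hx₀ s₀ he0
    have hvz : s₀.v = bz (Wn s₀) x₀ := hbr.unique (isBracket_bz (Wn s₀) x₀)
    have hind' : IndepBrκ (Wn s₀) x₀ (x₀ - bz (Wn s₀) x₀) (ιS S) σ := by
      have h' : IndepBrκ (Wn s₀) x₀ (x₀ - s₀.v) (ιS S) σ := hind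
      rw [hvz] at h'
      exact h'
    exact not_indepBrκ_of_degenerate hτ hlt (Wn_intertwine s₀) hc x₀ hσ hind'
  · -- non-degenerate start: the potential `cyc` along the orbit
    have h00 : cf s₀.V 0 ≠ 0 := fun h0 => hdeg (Or.inl h0)
    have h11 : cf s₀.V 1 ≠ 0 := fun h1 => hdeg (Or.inr h1)
    set ρ : ℝ := (1 + 4 * (2 * β / σ) * τ) ^ 2 with hρ
    set K : ℝ := 22 / σ + 1 with hK
    have hK0 : 0 ≤ K := by positivity
    have iter : ∀ n : ℕ, ∃ s : State (TD τ) x₀ S, ReachD (ιS S) σ β s₀ s ∧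
        s.etheta = (1 - β) ^ n * s₀.etheta ∧ cf s.V 0 ≠ 0 ∧ cf s.V 1 ≠ 0 ∧ cyc s₀.V ≤ ρ ^ n * cyc s.V := by
      intro n
      induction n with
      | zero => exact ⟨s₀, ReachD.start, by rw [pow_zero, one_mul], h00, h11, by rw [pow_zero, one_mul]⟩
      | succ n ih =>
        obtain ⟨s, hs, hes, hc0, hc1, hcyc⟩ := ih
        have he : 0 < s.etheta := by rw [hes]; exact mul_pos (pow_pos (by linarith) _) he0
        have hRs : |s.ε ^ 2 - s₀.ε ^ 2| ≤ K * (s₀.etheta - s.etheta) := hs.radInv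
        have hβe : K * β * s.etheta ≤ K * s.etheta := by
          have h1 : β * s.etheta ≤ s.etheta := mul_le_of_le_one_left he.le hβ1.le
          have h2 := mul_le_mul_of_nonneg_left h1 hK0
          linarith [h2]
        have hab := abs_le.1 hRs
        have hlo : (0.09 : ℝ) + (22 / σ + 1) * β * s.etheta ≤ s.ε ^ 2 := by
          rw [← hK]; linarith [hab.1, hstart.1]
        have hhi : s.ε ^ 2 + (22 / σ + 1) * β * s.etheta ≤ 0.49 := by
          rw [← hK]; linarith [hab.2, hstart.2]
        obtain ⟨s', h1, -, h3, h4, p, hp, hV'⟩ := exists_state_stepκ hιs hι1 hιS hx₀ s he hσ hσ1 hβ0.le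
          hβ (x₀ - s.v) (h s s hs hs (invP_self' _ s _) he) hlo hhi
        have hN : ‖ιS S p‖ ≤ 2 * β / σ := (hι1 p).trans hp
        obtain ⟨r, hr, hW⟩ := Wn_eq_smul hx₀ s he
        have hV'' : s'.V = r • (s.V ∘L (1 + ιS S p)) := by rw [hV', hW, smul_comp]
        obtain ⟨hc0', hc1', hst⟩ := cyc_step hτ hτ2 (state_intertwine s) (hιS p) hN hν hc0 hc1
        refine ⟨s', hs.step he ⟨p, hp, hV'⟩ h1 h3 h4, by rw [h1, hes, pow_succ]; ring, ?_, ?_, ?_⟩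
        · rw [hV'', cf_smul]; exact mul_ne_zero ((map_ne_zero _).2 hr) hc0'
        · rw [hV'', cf_smul]; exact mul_ne_zero ((map_ne_zero _).2 hr) hc1'
        · rw [hV'', cyc_smul hr, pow_succ, mul_assoc]
          have hρ0 : 0 ≤ ρ ^ n := by positivity
          exact hcyc.trans (mul_le_mul_of_nonneg_left hst hρ0)
    -- the state bound along the orbit
    have hΔ := Δ_pos hτ hlt
    have hcyc0 : 0 < cyc s₀.V := by
      have h0 := norm_pos_iff.2 h00
      have h1 := norm_pos_iff.2 h11
      rw [cyc]; positivity
    have hbound : ∀ n : ℕ, 0.0081 * Δ τ * cyc s₀.V ≤ ((1 - β) ^ 2 * ρ) ^ n * s₀.etheta ^ 2 := by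
      intro n
      obtain ⟨s, hs, hes, hc0, hc1, hcyc⟩ := iter n
      have he : 0 < s.etheta := by rw [hes]; exact mul_pos (pow_pos (by linarith) _) he0
      have hbr : IsBracket (Wn s) x₀ s.v := isBracket_Wn hx₀ s he
      have hes' : ‖adjoint (Wn s) s.v‖ ^ 2 = s.etheta := by rw [etheta_eq_eth, eth_eq_of_isBracket hbr]
      have hb := cyc_le hτ hτ2 (Wn_intertwine s) hbr (s.window hx₀).1 (norm_x₀_sub_v_ge hx₀ s)
      obtain ⟨r, hr, hW⟩ := Wn_eq_smul hx₀ s he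
      rw [hes', hes, hW, cyc_smul hr] at hb
      have hρn : 0 < ρ ^ n := by positivity
      have h1 : 0.0081 * Δ τ * cyc s₀.V ≤ ρ ^ n * (0.0081 * Δ τ * cyc s.V) := by
        nlinarith [mul_le_mul_of_nonneg_left hcyc (by positivity : (0:ℝ) ≤ 0.0081 * Δ τ)]
      calc 0.0081 * Δ τ * cyc s₀.V ≤ ρ ^ n * (0.0081 * Δ τ * cyc s.V) := h1
        _ ≤ ρ ^ n * (((1 - β) ^ n * s₀.etheta) ^ 2) := mul_le_mul_of_nonneg_left hb hρn.le
        _ = ((1 - β) ^ 2 * ρ) ^ n * s₀.etheta ^ 2 := by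
          have e2 : ((1 - β) ^ n * s₀.etheta) ^ 2 = ((1 - β) ^ 2) ^ n * s₀.etheta ^ 2 := by
            rw [mul_pow, ← pow_mul, ← pow_mul, mul_comm n 2]
          rw [e2, mul_pow]; ring
    -- closure: `(1−β)²ρ = ((1−β)(1 + 8βτ/σ))² < 1` since `8τ/σ ≤ 0.08 < 1`
    have hq0 : 0 ≤ (1 - β) * (1 + 4 * (2 * β / σ) * τ) := by
      have : 0 ≤ 4 * (2 * β / σ) * τ := by positivity
      nlinarith
    have hq1 : (1 - β) * (1 + 4 * (2 * β / σ) * τ) < 1 := by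
      have h8 : 4 * (2 * β / σ) * τ ≤ 0.08 * β := by
        rw [show 4 * (2 * β / σ) * τ = β * (8 * τ / σ) by ring]
        have : 8 * τ / σ ≤ 0.08 := by rw [div_le_iff₀ hσ]; linarith
        nlinarith
      nlinarith
    have hr1 : (1 - β) ^ 2 * ρ < 1 := by
      have e : (1 - β) ^ 2 * ρ = ((1 - β) * (1 + 4 * (2 * β / σ) * τ)) ^ 2 := by rw [hρ]; ring
      rw [e]
      exact pow_lt_one₀ hq0 hq1 two_ne_zero
    obtain ⟨n, hn⟩ := exists_pow_mul_lt (E := s₀.etheta ^ 2) (by positivity) hr1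
      (by positivity : (0 : ℝ) < 0.0081 * Δ τ * cyc s₀.V)
    linarith [hbound n]

/-- **`IndepRunD` IS FALSE IN THE TYPE-1 MODEL**: for `0 < τ ≤ σ/100`, `0 < σ ≤ 1`, `0 < β ≤ σ²/1000` there is an
admissible start (unit `x₀`, true MC state `s₀` of a `V_y` over the shift `S` on `ℓ²`, with the start margin and
`(εθ)₀ > 0`) at which the orbit-form hypothesis fails. [cite: Enflo2023, v2 (34) p.16; p.19–20] -/
theorem not_indepRunD {σ β : ℝ} (hτ : 0 < τ) (hσ : 0 < σ) (hσ1 : σ ≤ 1) (hτσ : τ ≤ σ / 100)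
    (hβ0 : 0 < β) (hβ : β ≤ σ ^ 2 / 1000) :
    ∃ (x₀ : C2) (s₀ : State (TD τ) x₀ S), ‖x₀‖ = 1 ∧ 0 < s₀.etheta ∧
      ((0.09 : ℝ) + (22 / σ + 1) * s₀.etheta ≤ s₀.ε ^ 2 ∧ s₀.ε ^ 2 + (22 / σ + 1) * s₀.etheta ≤ 0.49) ∧
      ¬ IndepRunD (TD τ) x₀ S (ιS S) σ β s₀ := by
  obtain ⟨s₀, -, he, -, hstart⟩ := exists_start_at hτ hσ hσ1 hτσ
  exact ⟨xD, s₀, norm_xD, he, hstart,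
    fun h => he.ne' (indepRunD_etheta_eq_zero hτ norm_xD hσ hσ1 hτσ hβ0 hβ s₀ hstart h)⟩

end Diag

end StepRealisation

end Literature.Analysis.OperatorTheory.Enflo2023

end
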